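import Summits.MatrixMultiplication.MatrixMultiplication.Theses.ThinBlockAlpha
import Literature.Computability.AlgebraicComplexity.GroupTheoreticMatMulThmBProofs

/-!
# `RectangularThmB` (crux stmt-MatrixMultiplication-10597, route ThinBlockAlpha):
# load-bearing hypotheses, monotonicity, and the tightness bound `η(ℓ,a) ≤ a`

Negative-side support file of the crux disprover (cdisprove seat); everything `sorry`-free.
The crux: `∀ ℓ, ∀ a ∈ (0,1), ∃ η > 0`, every exponent-`≤ ℓ` abelian STPP family of thin blocks
`⟨N, M, N⟩`, `N ≥ 2`, `N^a ≤ M`, has `L · N^{2+η} < |H|`.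

* `Inner ℓ a η` / `rectangularThmB_iff` — the inner statement exposed; `Inner.mono_a`,
  `Inner.anti_ell`, `Inner.anti_eta` — monotone in `a`, antitone in `ℓ` and `η`.
* `rectangularThmB_false_without_N_ge_two` — with `2 ≤ N` dropped the statement is FALSE
  (trivial group, one block `⟨1,1,1⟩`): any proof must use `N ≥ 2`.
* `rectangularThmB_false_without_pos_a` — with `0 < a` weakened to `0 ≤ a` it is FALSE
  (`(ℤ/2)²`, one block `A = ℤ/2 × 0`, `B = {0}`, `C = 0 × ℤ/2`, `|H| = N²`): any proof must use
  `a > 0` quantitatively.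
* `rectangularThmB_iff_allPosA` — `a < 1` is decoration; `rectangularThmB_iff_small_a` — it
  suffices to treat arbitrarily small `a` (for each `ℓ`).
* `thinPackings_imp_not_withoutExpBound` — without the exponent bound the statement contradicts
  the sibling crux `ThinPackings` at `a = 1/2`: the exponent bound carries the content.
* `eta_le_a` — TIGHTNESS: for `ℓ ≥ 2` any admissible `η` has `η ≤ a` (one coordinate block
  `𝔽₂ⁿ ⊕ 𝔽₂ᵐ ⊕ 𝔽₂ⁿ`, `|H| = N² M`); `not_uniform_eta` — hence no `η` uniform in `a`.
* `inner_of_thmB` — the FAT range is already a theorem: from the tree's Thm B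
  (`BlasiakChurchCohnGrochowNaslundSawinUmans2017_B_holds`), for every `ℓ` there is `a₀ < 1` with
  `Inner ℓ a η(a)` for all `a > a₀`; so the restatement `∀ ℓ ∃ a₀ < 1 ∀ a ∈ (a₀,1) ∃ η` (item note
  g41-20) is proved, and any counterexample to the crux lives at `a ≤ a₀(ℓ)`.

Details and the running analysis: `Cruxes/RectangularThmB/Disproof.lean`.

Maintenance record (full-build repair, 2026-08-17; dependency drift, content unchanged). The crux was REFUTED on
2026-08-16 (`Theorems.not_RectangularThmB`, p84448; stmt-MatrixMultiplication-10597 closed `refuted`, settled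
negative knowledge) and route ThinBlockAlpha rev 6 (2026-08-16T08:57Z) DROPPED the decl
`Summit.MatrixMultiplication.MatrixMultiplication.Theses.ThinBlockAlpha.RectangularThmB` from the gate-generated route
file, after which this file (52:4, 139:38, 153:4: the short name came from `open …Theses.ThinBlockAlpha`) and the
refutation file `Theorems/ThinBlockAlphaRectangularThmBRefutation.lean` (`not_RectangularThmB : ¬ RectangularThmB`)
stopped elaborating. Repair, as prescribed by the route's PROVER NOTE (item #9 BoundedExponentTwoSevenths): the
refuted statement is RECORDED below under its exact former name with its ledger signature VERBATIM — here, in the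
lightweight negative-support file, which the refutation file then imports (one record for both; standard record
patch, cf. `Theorems/LevelGradedCohnUmansLevelTwoBeatsCubesRefutation.lean`). Every signature and proof below is
byte-for-byte the landed one (p77258). A FALSE proposition recorded as a definition — never asserted, not a cited
fact, not a route item.
-/

-- `Summit.<Summit>.<Problem>` is the mandated summit-side namespace (CONVENTIONS §2); for the
-- single-conjunct summit `MatrixMultiplication` the two coincide, so the duplicate is deliberate.
set_option linter.dupNamespace false

/-! ## Record of the dropped (refuted) crux statement (stmt-MatrixMultiplication-10597) -/

namespace Summit.MatrixMultiplication.MatrixMultiplication.Theses.ThinBlockAlpha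

/-- **RECORD of the dropped route decl `ThinBlockAlpha.RectangularThmB`** (ex-crux / support r4 of route
ThinBlockAlpha, stmt-MatrixMultiplication-10597; verbatim its ledger signature), under its former name: for every
exponent bound `ℓ` and every shape exponent `a ∈ (0,1)` there is `η > 0` such that every abelian STPP family of
`L` thin blocks `⟨N, M, N⟩`, `N ≥ 2`, `N^a ≤ M`, in a finite abelian group `H` of exponent `≤ ℓ` has
`L · N^{2+η} < |H|` ("bounded exponent kills every thin shape at some slack"). REFUTED 2026-08-16 at
`(ℓ, a) = (9, 2/7)` by `Summit.MatrixMultiplication.MatrixMultiplication.Theorems.not_RectangularThmB` (null-offset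
chart family in `(ℤ/9)^{18m}`, p84448) and dropped from the gate-generated route file at rev 6; kept HERE, the
common lightweight import of the negative-side lemmas and of the refutation, solely so that they keep elaborating
unchanged. A FALSE proposition recorded as a definition — never asserted, not a cited fact, not a route item. -/
def RectangularThmB : Prop :=
  ∀ ℓ : ℕ, ∀ a : ℝ, 0 < a → a < 1 → ∃ η : ℝ, 0 < η ∧ ∀ (H : Type) [AddCommGroup H] [Fintype H], AddMonoid.exponent H ≤ ℓ → ∀ (L N M : ℕ) (A B C : Fin L → Finset H), Literature.Computability.AlgebraicComplexity.IsSTPP A B C → (∀ i, (A i).card = N ∧ (B i).card = M ∧ (C i).card = N) → 2 ≤ N → (N : ℝ) ^ a ≤ M → (L : ℝ) * (N : ℝ) ^ (2 + η) < Fintype.card H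

end Summit.MatrixMultiplication.MatrixMultiplication.Theses.ThinBlockAlpha

namespace Summit.MatrixMultiplication.MatrixMultiplication.Theorems.RectangularThmB.Negative

open Literature.Computability.AlgebraicComplexity
open Summit.MatrixMultiplication.MatrixMultiplication.Theses.ThinBlockAlpha

noncomputable section

/-! ## §0 The inner statement and its monotonicity -/

/-- The inner statement of the crux at parameters `(ℓ, a, η)`: every exponent-`≤ ℓ` abelian STPP
family of blocks `⟨N,M,N⟩`, `N ≥ 2`, `N^a ≤ M`, has `L · N^{2+η} < |H|`. -/
def Inner (ℓ : ℕ) (a η : ℝ) : Prop :=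
  ∀ (H : Type) [AddCommGroup H] [Fintype H], AddMonoid.exponent H ≤ ℓ →
    ∀ (L N M : ℕ) (A B C : Fin L → Finset H), IsSTPP A B C →
      (∀ i, (A i).card = N ∧ (B i).card = M ∧ (C i).card = N) → 2 ≤ N → (N : ℝ) ^ a ≤ M →
        (L : ℝ) * (N : ℝ) ^ (2 + η) < Fintype.card H

/-- The crux, refolded through `Inner` (definitional). -/
theorem rectangularThmB_iff :
    RectangularThmB ↔ ∀ ℓ : ℕ, ∀ a : ℝ, 0 < a → a < 1 → ∃ η : ℝ, 0 < η ∧ Inner ℓ a η :=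
  Iff.rfl

/-- `Inner` is monotone in the shape exponent `a` (a larger `a` restricts the families). -/
theorem Inner.mono_a {ℓ : ℕ} {a a' η : ℝ} (haa' : a ≤ a') (h : Inner ℓ a η) : Inner ℓ a' η := by
  intro H _ _ hexp L N M A B C hS hc hN hM
  refine h H hexp L N M A B C hS hc hN (le_trans ?_ hM)
  have hN1 : (1 : ℝ) ≤ N := by exact_mod_cast le_trans (by norm_num) hN
  exact Real.rpow_le_rpow_of_exponent_le hN1 haa'

/-- `Inner` is antitone in the exponent bound `ℓ`. -/
theorem Inner.anti_ell {ℓ ℓ' : ℕ} {a η : ℝ} (hℓ : ℓ' ≤ ℓ) (h : Inner ℓ a η) : Inner ℓ' a η :=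
  fun H _ _ hexp => h H (le_trans hexp hℓ)

/-- `Inner` is antitone in `η` (a smaller `η` is a weaker conclusion). -/
theorem Inner.anti_eta {ℓ : ℕ} {a η η' : ℝ} (hη : η' ≤ η) (h : Inner ℓ a η) : Inner ℓ a η' := by
  intro H _ _ hexp L N M A B C hS hc hN hM
  refine lt_of_le_of_lt ?_ (h H hexp L N M A B C hS hc hN hM)
  have hN1 : (1 : ℝ) ≤ N := by exact_mod_cast le_trans (by norm_num) hN
  exact mul_le_mul_of_nonneg_left (Real.rpow_le_rpow_of_exponent_le hN1 (by linarith))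
    (Nat.cast_nonneg L)

/-! ## §A Load-bearing hypotheses -/

/-- The crux with the hypothesis `2 ≤ N` dropped. -/
def RectangularThmBWithoutNGeTwo : Prop :=
  ∀ ℓ : ℕ, ∀ a : ℝ, 0 < a → a < 1 → ∃ η : ℝ, 0 < η ∧
    ∀ (H : Type) [AddCommGroup H] [Fintype H], AddMonoid.exponent H ≤ ℓ →
      ∀ (L N M : ℕ) (A B C : Fin L → Finset H), IsSTPP A B C →
        (∀ i, (A i).card = N ∧ (B i).card = M ∧ (C i).card = N) → (N : ℝ) ^ a ≤ M →
          (L : ℝ) * (N : ℝ) ^ (2 + η) < Fintype.card H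

/-- `2 ≤ N` is load-bearing: without it the trivial group with the single block `⟨1,1,1⟩`
(`A = B = C = {0}`, exponent `1 ≤ ℓ := 1`, `a := 1/2`) violates `1 · 1^{2+η} < |H| = 1`. -/
theorem rectangularThmB_false_without_N_ge_two : ¬ RectangularThmBWithoutNGeTwo := by
  intro h
  obtain ⟨η, _, h'⟩ := h 1 (1 / 2) (by norm_num) (by norm_num)
  haveI : Subsingleton (ZMod 1) := ZMod.subsingleton_iff.mpr rfl
  have key := h' (ZMod 1) (by rw [ZMod.exponent]) 1 1 1 (fun _ => {0}) (fun _ => {0}) (fun _ => {0})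
    (fun i j k s _ s' _ t _ t' _ u _ u' _ _ => ⟨Subsingleton.elim _ _, Subsingleton.elim _ _,
      Subsingleton.elim _ _, Subsingleton.elim _ _, Subsingleton.elim _ _⟩)
    (fun _ => by simp) (by simp)
  simp at key

/-- The crux with `0 < a` weakened to `0 ≤ a` (the `a = 0` endpoint admitted). -/
def RectangularThmBWithoutPosA : Prop :=
  ∀ ℓ : ℕ, ∀ a : ℝ, 0 ≤ a → a < 1 → ∃ η : ℝ, 0 < η ∧ Inner ℓ a η

/-- the `a = 0` witness: one block `⟨2,1,2⟩` in `(ℤ/2)²`, first leg `ℤ/2 × 0` -/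
def wA : Fin 1 → Finset (ZMod 2 × ZMod 2) := fun _ => {(0, 0), (1, 0)}
/-- the `a = 0` witness, middle leg `{0}` -/
def wB : Fin 1 → Finset (ZMod 2 × ZMod 2) := fun _ => {(0, 0)}
/-- the `a = 0` witness, third leg `0 × ℤ/2` -/
def wC : Fin 1 → Finset (ZMod 2 × ZMod 2) := fun _ => {(0, 0), (0, 1)}

/-- The `a = 0` witness is an STPP family (a single TPP triple). -/
theorem w_isSTPP : IsSTPP wA wB wC := by
  intro i j k s hs s' hs' t ht t' ht' u hu u' hu' hsum
  refine ⟨Subsingleton.elim _ _, Subsingleton.elim _ _, ?_⟩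
  simp only [wA, wB, wC, Finset.mem_insert, Finset.mem_singleton] at hs hs' ht ht' hu hu'
  subst ht; subst ht'
  rcases hs with rfl | rfl <;> rcases hs' with rfl | rfl <;> rcases hu with rfl | rfl <;>
    rcases hu' with rfl | rfl <;> revert hsum <;> decide

/-- `0 < a` is load-bearing: at `a = 0` the one-block coset design `A = ℤ/2 × 0`, `B = {0}`,
`C = 0 × ℤ/2` in `H = (ℤ/2)²` (exponent 2, `N = 2`, `M = 1 = N⁰`) has `|H| = N² = 4 ≤ N^{2+η}`. -/
theorem rectangularThmB_false_without_pos_a : ¬ RectangularThmBWithoutPosA := by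
  intro h
  obtain ⟨η, hη, h'⟩ := h 2 0 le_rfl (by norm_num)
  have hexp : AddMonoid.exponent (ZMod 2 × ZMod 2) ≤ 2 := by
    rw [AddMonoid.exponent_prod, ZMod.exponent]; decide
  have key := h' (ZMod 2 × ZMod 2) hexp 1 2 1 wA wB wC w_isSTPP
    (fun _ => by simp only [wA, wB, wC]; decide) le_rfl (by simp)
  have h4 : (4 : ℝ) ≤ (2 : ℝ) ^ (2 + η) := by
    have h22 := Real.rpow_le_rpow_of_exponent_le (by norm_num : (1 : ℝ) ≤ 2)
      (by linarith : (2 : ℝ) ≤ 2 + η)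
    have : (2 : ℝ) ^ (2 : ℝ) = 4 := by rw [Real.rpow_two]; norm_num
    linarith
  simp at key
  linarith

/-- The crux with `a < 1` dropped (all `a > 0`). -/
def RectangularThmBAllPosA : Prop :=
  ∀ ℓ : ℕ, ∀ a : ℝ, 0 < a → ∃ η : ℝ, 0 < η ∧ Inner ℓ a η

/-- `a < 1` is NOT load-bearing: the crux is equivalent to its `∀ a > 0` form (monotonicity in
`a`; for `a ≥ 1` use the `η` of `a = 1/2`). -/
theorem rectangularThmB_iff_allPosA : RectangularThmB ↔ RectangularThmBAllPosA := by
  rw [rectangularThmB_iff]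
  constructor
  · intro h ℓ a ha
    by_cases ha1 : a < 1
    · exact h ℓ a ha ha1
    · obtain ⟨η, hη, hI⟩ := h ℓ (1 / 2) (by norm_num) (by norm_num)
      exact ⟨η, hη, hI.mono_a (by linarith [not_lt.mp ha1])⟩
  · intro h ℓ a ha _
    exact h ℓ a ha

/-- The crux is equivalent to its own small-`a` tail: it suffices to treat, for each `ℓ`,
arbitrarily small shape exponents `a`. -/
theorem rectangularThmB_iff_small_a :
    RectangularThmB ↔
      ∀ ℓ : ℕ, ∀ a₀ : ℝ, 0 < a₀ → ∃ a : ℝ, 0 < a ∧ a ≤ a₀ ∧ ∃ η : ℝ, 0 < η ∧ Inner ℓ a η := by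
  rw [rectangularThmB_iff]
  constructor
  · intro h ℓ a₀ ha₀
    obtain ⟨η, hη, hI⟩ := h ℓ (min a₀ (1 / 2)) (lt_min ha₀ (by norm_num))
      (lt_of_le_of_lt (min_le_right _ _) (by norm_num))
    exact ⟨min a₀ (1 / 2), lt_min ha₀ (by norm_num), min_le_left _ _, η, hη, hI⟩
  · intro h ℓ a ha _
    obtain ⟨a', _, ha'a, η, hη, hI⟩ := h ℓ a ha
    exact ⟨η, hη, hI.mono_a ha'a⟩

/-- The crux with the exponent bound dropped ("thin Theorem B for ALL finite abelian groups"). -/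
def RectangularThmBWithoutExpBound : Prop :=
  ∀ a : ℝ, 0 < a → a < 1 → ∃ η : ℝ, 0 < η ∧
    ∀ (H : Type) [AddCommGroup H] [Fintype H] (L N M : ℕ) (A B C : Fin L → Finset H),
      IsSTPP A B C → (∀ i, (A i).card = N ∧ (B i).card = M ∧ (C i).card = N) → 2 ≤ N →
        (N : ℝ) ^ a ≤ M → (L : ℝ) * (N : ℝ) ^ (2 + η) < Fintype.card H

/-- Dropping the exponent bound turns the crux into a statement that contradicts the sibling crux
`ThinPackings` (already at `a = 1/2`): the exponent bound is exactly what separates this crux from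
`¬ ThinPackings`; open both ways (the trivial converse `RectangularThmBWithoutExpBound → RectangularThmB`
is in the disprover's work file). -/
theorem thinPackings_imp_not_withoutExpBound : ThinPackings → ¬ RectangularThmBWithoutExpBound := by
  intro hT h
  obtain ⟨η, hη, h'⟩ := h (1 / 2) (by norm_num) (by norm_num)
  obtain ⟨H, i1, i2, L, N, M, A, B, C, hS, hc, hN, hM, hP⟩ :=
    hT (1 / 2) (by norm_num) (by norm_num) η hη
  have := h' H L N M A B C hS hc hN hM
  linarith

/-! ## §B Tightness: `η(ℓ, a) ≤ a` — the one-block coordinate design `𝔽₂ⁿ ⊕ 𝔽₂ᵐ ⊕ 𝔽₂ⁿ` -/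

/-- host group `𝔽₂ⁿ × 𝔽₂ᵐ × 𝔽₂ⁿ` -/
abbrev Host (n m : ℕ) : Type := (Fin n → ZMod 2) × (Fin m → ZMod 2) × (Fin n → ZMod 2)

/-- first coordinate block -/
def blkA (n m : ℕ) : Finset (Host n m) := Finset.univ.image fun x => (x, 0, 0)
/-- middle coordinate block -/
def blkB (n m : ℕ) : Finset (Host n m) := Finset.univ.image fun y => (0, y, 0)
/-- last coordinate block -/
def blkC (n m : ℕ) : Finset (Host n m) := Finset.univ.image fun z => (0, 0, z)

/-- `|blkA| = 2ⁿ`. -/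
theorem card_blkA (n m : ℕ) : (blkA n m).card = 2 ^ n := by
  rw [blkA, Finset.card_image_of_injective _ (fun x x' h => by simpa using congrArg Prod.fst h)]
  simp

/-- `|blkB| = 2ᵐ`. -/
theorem card_blkB (n m : ℕ) : (blkB n m).card = 2 ^ m := by
  rw [blkB, Finset.card_image_of_injective _
    (fun x x' h => by simpa using congrArg (fun p => p.2.1) h)]
  simp

/-- `|blkC| = 2ⁿ`. -/
theorem card_blkC (n m : ℕ) : (blkC n m).card = 2 ^ n := by
  rw [blkC, Finset.card_image_of_injective _
    (fun x x' h => by simpa using congrArg (fun p => p.2.2) h)]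
  simp

/-- `|Host n m| = 2ⁿ·2ᵐ·2ⁿ`. -/
theorem card_host (n m : ℕ) : Fintype.card (Host n m) = 2 ^ n * (2 ^ m * 2 ^ n) := by
  simp [Fintype.card_prod]

/-- The host `𝔽₂ⁿ × 𝔽₂ᵐ × 𝔽₂ⁿ` has exponent `≤ 2`. -/
theorem exponent_host_le (n m : ℕ) : AddMonoid.exponent (Host n m) ≤ 2 := by
  have h2 : ∀ x : ZMod 2, x + x = 0 := by decide
  apply Nat.le_of_dvd two_pos
  apply AddMonoid.exponent_dvd_of_forall_nsmul_eq_zero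
  intro g
  rw [two_nsmul]
  refine Prod.ext ?_ (Prod.ext ?_ ?_) <;> funext i <;> simp [h2]

/-- The one-block coordinate design is an STPP family (it is a single TPP triple: direct sum). -/
theorem oneBlock_isSTPP (n m : ℕ) :
    IsSTPP (fun _ : Fin 1 => blkA n m) (fun _ => blkB n m) (fun _ => blkC n m) := by
  intro i j k s hs s' hs' t ht t' ht' u hu u' hu' hsum
  simp only [blkA, blkB, blkC, Finset.mem_image, Finset.mem_univ, true_and] at hs hs' ht ht' hu hu'
  obtain ⟨x, rfl⟩ := hs
  obtain ⟨x', rfl⟩ := hs'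
  obtain ⟨y, rfl⟩ := ht
  obtain ⟨y', rfl⟩ := ht'
  obtain ⟨z, rfl⟩ := hu
  obtain ⟨z', rfl⟩ := hu'
  refine ⟨Subsingleton.elim _ _, Subsingleton.elim _ _, ?_⟩
  simp only [Prod.mk_sub_mk, Prod.mk_add_mk, add_zero, zero_add, sub_self,
    Prod.mk_eq_zero] at hsum
  obtain ⟨hx, hy, hz⟩ := hsum
  rw [sub_eq_zero] at hx hy hz
  subst hx; subst hy; subst hz
  exact ⟨rfl, rfl, rfl⟩

/-- **Tightness.** For `ℓ ≥ 2` and `0 < a`, any `η` for which the inner statement holds satisfies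
`η ≤ a`: the single block `⟨2ⁿ, 2ᵐ, 2ⁿ⟩`, `m = ⌈a n⌉`, in `𝔽₂^{2n+m}` has `|H| = N² M ≤ N^{2+η}` as
soon as `m ≤ η n`.  So `η(ℓ, a) → 0` as `a → 0⁺` is forced, matching §A (`a = 0` is false). -/
theorem eta_le_a {ℓ : ℕ} (hℓ : 2 ≤ ℓ) {a η : ℝ} (ha : 0 < a) (h : Inner ℓ a η) : η ≤ a := by
  by_contra hle
  have hlt : a < η := lt_of_not_ge hle
  have hd : 0 < η - a := sub_pos.mpr hlt
  obtain ⟨n, hn⟩ := exists_nat_ge (2 / (η - a))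
  have hn2 : 2 ≤ (η - a) * n := by
    rw [div_le_iff₀ hd] at hn; linarith
  have hn0 : n ≠ 0 := by
    rintro rfl; norm_num at hn2
  set m : ℕ := ⌈a * n⌉₊ with hm
  have hm_ge : a * n ≤ m := Nat.le_ceil _
  have hm_lt : (m : ℝ) < a * n + 1 := Nat.ceil_lt_add_one (by positivity)
  have hmη : (m : ℝ) ≤ η * n := by linarith
  -- instantiate the inner statement at the one-block design
  have key := h (Host n m) (le_trans (exponent_host_le n m) hℓ) 1 (2 ^ n) (2 ^ m)
    (fun _ => blkA n m) (fun _ => blkB n m) (fun _ => blkC n m) (oneBlock_isSTPP n m)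
    (fun _ => ⟨card_blkA n m, card_blkB n m, card_blkC n m⟩) (Nat.le_self_pow hn0 2) ?_
  · -- contradiction: N^{2+η} = 2^{n(2+η)} ≥ 2^{2n+m} = |H|
    have lhs : ((1 : ℕ) : ℝ) * ((2 ^ n : ℕ) : ℝ) ^ (2 + η) = (2 : ℝ) ^ ((n : ℝ) * (2 + η)) := by
      rw [Nat.cast_one, one_mul, Nat.cast_pow, Nat.cast_ofNat, ← Real.rpow_natCast,
        ← Real.rpow_mul (by norm_num)]
    have rhs : (Fintype.card (Host n m) : ℝ) = (2 : ℝ) ^ ((2 * n + m : ℕ) : ℝ) := by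
      rw [card_host, Real.rpow_natCast]; push_cast; ring
    rw [lhs, rhs] at key
    have hexp : ((2 * n + m : ℕ) : ℝ) ≤ (n : ℝ) * (2 + η) := by push_cast; linarith
    have := Real.rpow_le_rpow_of_exponent_le (by norm_num : (1 : ℝ) ≤ 2) hexp
    linarith
  · -- N^a = 2^{na} ≤ 2^m = M
    rw [Nat.cast_pow, Nat.cast_pow, Nat.cast_ofNat, ← Real.rpow_natCast (2 : ℝ) n,
      ← Real.rpow_mul (by norm_num), ← Real.rpow_natCast (2 : ℝ) m]
    exact Real.rpow_le_rpow_of_exponent_le (by norm_num) (by linarith)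

/-! ## §C No `η` uniform in `a`; the fat range -/

/-- **No `η` uniform in `a`.** The strengthening `∀ ℓ ∃ η > 0 ∀ a ∈ (0,1)` of the crux is false
(take `a < η` in `eta_le_a`). Any proof must produce `η(ℓ, a)` degenerating as `a → 0`. -/
theorem not_uniform_eta : ¬ ∀ ℓ : ℕ, ∃ η : ℝ, 0 < η ∧ ∀ a : ℝ, 0 < a → a < 1 → Inner ℓ a η := by
  intro h
  obtain ⟨η, hη, h2⟩ := h 2
  have ha : 0 < min (η / 2) (1 / 2) := lt_min (by linarith) (by norm_num)
  have ha1 : min (η / 2) (1 / 2) < 1 := lt_of_le_of_lt (min_le_right _ _) (by norm_num)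
  have := eta_le_a le_rfl ha (h2 _ ha ha1)
  have : min (η / 2) (1 / 2) ≤ η / 2 := min_le_left _ _
  linarith


/-- From the tree's Theorem B (`BlasiakChurchCohnGrochowNaslundSawinUmans2017_B_holds`:
`Σᵢ (|Aᵢ||Bᵢ||Cᵢ|)^{(2+ε_ℓ)/3} ≤ |H|` in exponent `≤ ℓ`): for every `ℓ` there is `a₀ < 1` — namely
`a₀ = (2 - 2ε_ℓ)/(2 + ε_ℓ)` — such that `Inner ℓ a η` holds for every `a > a₀`, with
`η = ((2+a)(2+ε_ℓ) - 6)/6`.  This is precisely the RESTATED crux proposed in the item notes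
(g41-20: `∀ ℓ ∃ a₀ < 1 ∀ a ∈ (a₀,1) ∃ η`), so that restatement is a theorem already; the content of
`RectangularThmB` as filed is the complementary thin range `0 < a ≤ a₀(ℓ)` (`a₀(ℓ) → 1`), which is
where any counterexample must live (cf. `rectangularThmB_iff_small_a`). -/
theorem inner_of_thmB (ℓ : ℕ) :
    ∃ a₀ : ℝ, a₀ < 1 ∧ ∀ a : ℝ, a₀ < a → ∃ η : ℝ, 0 < η ∧ Inner ℓ a η := by
  obtain ⟨ε, hε, hB⟩ := BlasiakChurchCohnGrochowNaslundSawinUmans2017_B_holds ℓ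
  have h2ε : (0 : ℝ) < 2 + ε := by linarith
  refine ⟨(2 - 2 * ε) / (2 + ε), by rw [div_lt_one h2ε]; linarith, ?_⟩
  intro a ha
  rw [div_lt_iff₀ h2ε] at ha
  set η : ℝ := ((2 + a) * (2 + ε) - 6) / 6 with hηdef
  have hη : 0 < η := by
    rw [hηdef]; apply div_pos _ (by norm_num); nlinarith
  refine ⟨η, hη, ?_⟩
  intro H _ _ hexp L N M A B C hS hc hN hM
  have hsum := hB H hexp L A B C hS
  have hterm : ∀ i, ((((A i).card * (B i).card * (C i).card : ℕ)) : ℝ) ^ ((2 + ε) / 3)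
      = ((N : ℝ) * M * N) ^ ((2 + ε) / 3) := by
    intro i
    obtain ⟨h1, h2, h3⟩ := hc i
    rw [h1, h2, h3]
    push_cast
    rfl
  rw [Finset.sum_congr rfl (fun i _ => hterm i), Finset.sum_const, Finset.card_univ,
    Fintype.card_fin, nsmul_eq_mul] at hsum
  rcases Nat.eq_zero_or_pos L with rfl | hL
  · simp [Fintype.card_pos]
  have hN1 : (1 : ℝ) < N := by exact_mod_cast lt_of_lt_of_le one_lt_two hN
  have hNpos : (0 : ℝ) < N := by linarith
  have hexp_eq : (2 + a) * ((2 + ε) / 3) = 2 + 2 * η := by rw [hηdef]; ring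
  have step1 : (N : ℝ) ^ (2 + η) < (N : ℝ) ^ (2 + 2 * η) :=
    Real.rpow_lt_rpow_of_exponent_lt hN1 (by linarith)
  have step2 : (N : ℝ) ^ (2 + 2 * η) ≤ ((N : ℝ) * M * N) ^ ((2 + ε) / 3) := by
    rw [← hexp_eq, Real.rpow_mul hNpos.le]
    apply Real.rpow_le_rpow (by positivity) _ (by linarith)
    rw [Real.rpow_add hNpos, Real.rpow_two]
    calc (N : ℝ) ^ 2 * (N : ℝ) ^ a ≤ (N : ℝ) ^ 2 * M :=
          mul_le_mul_of_nonneg_left hM (by positivity)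
      _ = N * M * N := by ring
  have hLpos : (0 : ℝ) < L := by exact_mod_cast hL
  calc (L : ℝ) * (N : ℝ) ^ (2 + η) < L * ((N : ℝ) * M * N) ^ ((2 + ε) / 3) :=
        mul_lt_mul_of_pos_left (lt_of_lt_of_le step1 step2) hLpos
    _ ≤ Fintype.card H := hsum

end

end Summit.MatrixMultiplication.MatrixMultiplication.Theorems.RectangularThmB.Negative
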